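import Summits.Ventures.QEC.Census.FoldTrans
import HarnessLib

/-!
# Fold enumeration — level assembly (fold of kernels, lifting completeness one level, pair de-duplication)

Cell `qec`, PARTITION row type-11 ("kernel C"), soundness layer 6 of `Census/FoldDefs.lean`:
* `ker_foldW` — under the decided column-fold identity the fold maps kernel words to kernel words, and
  `popc_foldW_le` — does not increase weight;
* `complete_lift` — completeness (as `Matched`) of the small level plus `GoodFib` at every listed
  representative gives the fibre conclusion for EVERY big kernel word of weight `≤ W`;
* `goodFib_of_guarded` — processing only the outputs containing the section point `emb p₀` (one of each
  pair `{u, g·u}`) suffices.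
-/

namespace Summit.Ventures.QEC.Census.Fold

open Summit.Ventures.QEC.Census

namespace Geo

variable {G : Geo}

/-- `foldRowW_xor`: foldRowW xor (auxiliary lemma of the fold-certificate soundness chain). -/
theorem foldRowW_xor (G : Geo) (x y : ℕ) : G.foldRowW (x ^^^ y) = G.foldRowW x ^^^ G.foldRowW y := lin_xor _ _ _ _ _

/-- **The fold maps the big kernel into the small kernel** (given the column-fold identity). -/
theorem ker_foldW (hG : G.OK) {Cb Cs : TCode} (hCF : G.ColFold Cb Cs) {u : ℕ} (hker : Cb.ker G.n u) : Cs.ker G.ns (G.foldW u) := by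
  unfold TCode.ker at *
  rw [foldW, lin_lin]
  rw [lin_congr (i0 := 0) (h := fun J => G.foldRowW (Cb.col J)) (fun J hJ => by
      rw [Nat.zero_add, lin_two_pow _ _ 0 _ (hG.foldIdx_lt J hJ), Nat.zero_add, hCF J hJ]) u,
    ← map_lin_of_xor G.foldRowW (lin_zero _ _ _) (foldRowW_xor G), hker, foldRowW, lin_zero]

/-- The fold does not increase weight. -/
theorem popc_foldW_le (hG : G.OK) {u : ℕ} (hu : u < 2 ^ G.n) : popc G.ns (G.foldW u) ≤ popc G.n u := by
  rw [foldW_eq_parts, popc_eq_parts hG hu]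
  have := popc_xor_add G.ns (G.aPart u) (G.bPart u)
  omega

/-- `foldW_lt`: foldW lt (auxiliary lemma of the fold-certificate soundness chain). -/
theorem foldW_lt (hG : G.OK) (u : ℕ) : G.foldW u < 2 ^ G.ns :=
  lin_lt_two_pow _ _ _ (fun J hJ => Nat.pow_lt_pow_right (by norm_num) (hG.foldIdx_lt J hJ)) u

end Geo

/-! ## Lifting completeness one level -/

/-- **COMPLETENESS LIFT.**  If every small kernel word of weight `≤ W` translates onto a listed
representative (`hbase`), `GoodFib … Q` holds at every representative (`hreps`), `Q` is closed under
un-translating, and the structural facts hold, then `Q` holds for every big kernel word of weight `≤ W`. -/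
theorem complete_lift {G : Geo} (hS : G.Shape) (hG : G.OK) {Cb Cs : TCode} (hCb : Cb.l = G.l ∧ Cb.m = G.m)
    (_hCs : Cs.l = G.ls ∧ Cs.m = G.ms) (hCF : G.ColFold Cb Cs)
    (heq : ∀ da db, Cb.ColEquiv da db) (hcol : ∀ J, J < Cb.n → Cb.col J < 2 ^ (Cb.l * Cb.m))
    {W : ℕ} {Ts : List ℕ} {Q : ℕ → Prop} (hQ : ∀ da db u, Q (transW G.l G.m da db u) → Q u)
    (hbase : ∀ s, s < 2 ^ G.ns → Cs.ker G.ns s → popc G.ns s ≤ W → Matched G.ls G.ms Ts s)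
    (hreps : ∀ t ∈ Ts, GoodFib G Cb W Q t) :
    ∀ u, u < 2 ^ G.n → Cb.ker G.n u → popc G.n u ≤ W → Q u := by
  intro u hu hker hwt
  have hsk : Cs.ker G.ns (G.foldW u) := Geo.ker_foldW hG hCF hker
  obtain ⟨t, ht, da, db, htr⟩ := hbase _ (Geo.foldW_lt hG u) hsk ((Geo.popc_foldW_le hG hu).trans hwt)
  have hgood : GoodFib G Cb W Q (transW G.ls G.ms da db (G.foldW u)) := by rw [htr]; exact hreps t ht
  exact goodFib_of_trans hS hG hCb (heq da db) hcol (hQ da db) hgood u hu hker hwt rfl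

/-! ## Pair de-duplication by the fibre generator -/

namespace Geo

variable {G : Geo}

/-- `gen_fst`: gen fst (auxiliary lemma of the fold-certificate soundness chain). -/
theorem gen_fst (G : Geo) : G.gen.1 = if G.ax then G.l / 2 else 0 := by unfold gen; split <;> rfl
/-- `gen_snd`: gen snd (auxiliary lemma of the fold-certificate soundness chain). -/
theorem gen_snd (G : Geo) : G.gen.2 = if G.ax then 0 else G.m / 2 := by unfold gen; split <;> rfl

/-- The partner map IS the translation by the fibre generator. -/
theorem partner_eq_transIdx (hS : G.Shape) {J : ℕ} (_hJ : J < G.n) :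
    G.partner J = transIdx G.l G.m G.gen.1 G.gen.2 J := by
  rw [transIdx_eq, idx_decomp G.l G.m J] -- both sides in coordinates
  set blk := J / (G.l * G.m)
  set a := J % (G.l * G.m) / G.m
  set b := J % (G.l * G.m) % G.m
  have ha : a < G.l := coord_a_lt hS.m_pos hS.l_pos
  have hb : b < G.m := coord_b_lt hS.m_pos
  obtain ⟨e1, e2, e3⟩ := coords_of_mk (A := blk) hS.l_pos hS.m_pos ha hb
  unfold partner
  simp only []
  rw [show blk * (G.l * G.m) + (a * G.m + b) = blk * (G.l * G.m) + a * G.m + b from by ring, e1, e2, e3, gen_fst, gen_snd]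
  cases G.ax <;> simp [Nat.mod_eq_of_lt ha, Nat.mod_eq_of_lt hb]

/-- The generator acts trivially on the small torus. -/
theorem transW_gen_small (hS : G.Shape) {v : ℕ} (hv : v < 2 ^ G.ns) : transW G.ls G.ms G.gen.1 G.gen.2 v = v := by
  have h1 : G.gen.1 % G.ls = 0 := by
    rw [gen_fst]; have := hS.ax_even
    cases hax : G.ax
    · simp
    · simp only [if_true]; unfold ls; rw [if_pos hax]; exact Nat.mod_self _
  have h2 : G.gen.2 % G.ms = 0 := by
    rw [gen_snd]; have := hS.ax_even
    cases hax : G.ax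
    · simp only [Bool.false_eq_true, if_false]; unfold ms; rw [if_neg (by simp [hax])]; exact Nat.mod_self _
    · simp
  rw [← transW_mod, h1, h2, transW_zero hS.ls_pos hS.ms_pos (by rw [← ns_eq]; exact hv)]

/-- Bits of a translated word. -/
theorem testBit_transW {l m : ℕ} (hl : 0 < l) (hm : 0 < m) (da db u : ℕ) {J : ℕ} (hJ : J < 2 * (l * m))
    (_hu : u < 2 ^ (2 * (l * m))) : (transW l m da db u).testBit (transIdx l m da db J) = u.testBit J := by
  rw [transW]
  rcases hb : u.testBit J with _ | _
  · rw [Bool.eq_false_iff]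
    intro h
    obtain ⟨k, hk, huk, he⟩ := (testBit_lin_pow_iff _ _ 0 u _
      (fun k₁ k₂ h₁ h₂ e => transIdx_inj hl hm da db h₁ h₂ (by simpa using e))).1 h
    simp only [Nat.zero_add] at he
    have := transIdx_inj hl hm da db hk hJ he
    subst this
    rw [hb] at huk; exact Bool.false_ne_true huk
  · exact (testBit_lin_pow_iff _ _ 0 u _
      (fun k₁ k₂ h₁ h₂ e => transIdx_inj hl hm da db h₁ h₂ (by simpa using e))).2 ⟨J, hJ, hb, by simp⟩

/-- Bit of a big word at a section point = bit of its section part. -/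
theorem testBit_emb_eq (hG : G.OK) {u : ℕ} (hu : u < 2 ^ G.n) {j : ℕ} (hj : j < G.ns) :
    u.testBit (G.emb j) = (G.aPart u).testBit j := by
  conv_lhs => rw [recon hG hu]
  rw [Nat.testBit_xor]
  have h2 : (G.parW (G.bPart u)).testBit (G.emb j) = false := by
    rw [Bool.eq_false_iff]; intro h
    obtain ⟨j', hj', -, he⟩ := (testBit_parW hG).1 h
    have := hG.fold_partner _ (hG.emb_lt j' hj')
    rw [he, hG.fold_emb j hj, hG.fold_emb j' hj'] at this
    subst this
    exact hG.partner_emb_ne _ hj' he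
  rw [h2, Bool.xor_false]
  rcases hb : (G.aPart u).testBit j with _ | _
  · rw [Bool.eq_false_iff]; intro h
    obtain ⟨j', hj', hb', he⟩ := (testBit_embW hG).1 h
    have := emb_inj hG hj' hj he; subst this
    rw [hb] at hb'; exact Bool.false_ne_true hb'
  · exact (testBit_embW hG).2 ⟨j, hj, hb, rfl⟩

/-- Bit of a big word at a partner point = bit of its partner part. -/
theorem testBit_partner_emb_eq (hG : G.OK) {u : ℕ} (hu : u < 2 ^ G.n) {j : ℕ} (hj : j < G.ns) :
    u.testBit (G.partner (G.emb j)) = (G.bPart u).testBit j := by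
  conv_lhs => rw [recon hG hu]
  rw [Nat.testBit_xor]
  have h1 : (G.embW (G.aPart u)).testBit (G.partner (G.emb j)) = false := by
    rw [Bool.eq_false_iff]; intro h
    obtain ⟨j', hj', -, he⟩ := (testBit_embW hG).1 h
    have := hG.fold_partner _ (hG.emb_lt j hj)
    rw [← he, hG.fold_emb j hj, hG.fold_emb j' hj'] at this
    subst this
    exact hG.partner_emb_ne _ hj he.symm
  rw [h1, Bool.false_xor]
  rcases hb : (G.bPart u).testBit j with _ | _
  · rw [Bool.eq_false_iff]; intro h
    obtain ⟨j', hj', hb', he⟩ := (testBit_parW hG).1 h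
    have := partner_emb_inj hG hj' hj he; subst this
    rw [hb] at hb'; exact Bool.false_ne_true hb'
  · exact (testBit_parW hG).2 ⟨j, hj, hb, rfl⟩

/-- **PAIR DE-DUPLICATION.**  If the fold `t` has bit `p₀` and the check established, for every word
of the fibre, "no bit at `emb p₀`, or `Q`", then `Q` holds on the whole fibre (`Q` translation-closed,
kernel translation-invariant). -/
theorem goodFib_of_guarded (hG : G.OK) (hS : G.Shape) {C : TCode} (hC : C.l = G.l ∧ C.m = G.m)
    (heq : C.ColEquiv G.gen.1 G.gen.2) (hcol : ∀ J, J < C.n → C.col J < 2 ^ (C.l * C.m))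
    {W t p₀ : ℕ} (ht : t < 2 ^ G.ns) (hp₀ : p₀ < G.ns) (htp : t.testBit p₀ = true) {Q : ℕ → Prop}
    (hQ : ∀ u, Q (transW G.l G.m G.gen.1 G.gen.2 u) → Q u)
    (h : GoodFib G C W (fun u => u.testBit (G.emb p₀) = false ∨ Q u) t) : GoodFib G C W Q t := by
  intro u hu hker hwt hfold
  rcases h u hu hker hwt hfold with hbit | hq
  · -- u misses emb p₀; its partner word g·u has it and is in the fibre
    have hl : 0 < G.l := hS.l_pos
    have hm : 0 < G.m := hS.m_pos
    have hn : C.n = G.n := by rw [TCode.n, Geo.n, hC.1, hC.2]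
    set u' := transW G.l G.m G.gen.1 G.gen.2 u with hu'
    have hu'lt : u' < 2 ^ G.n := by rw [Geo.n]; exact transW_lt hl hm _ _ u
    have hker' : C.ker G.n u' := by
      rw [← hn, hu', ← hC.1, ← hC.2, TCode.ker_transW_iff C (hC.1 ▸ hl) (hC.2 ▸ hm) heq hcol]; rw [hn]; exact hker
    have hwt' : popc G.n u' ≤ W := by rw [hu', Geo.n, popc_transW hl hm]; exact hwt
    have hfold' : G.foldW u' = t := by rw [hu', foldW_transW hS hG, hfold, transW_gen_small hS ht]
    rcases h u' hu'lt hker' hwt' hfold' with hbit' | hq'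
    · exfalso
      -- t has bit p₀: exactly one of u's bits at emb p₀ / partner (emb p₀) is set
      have hab : (G.aPart u ^^^ G.bPart u).testBit p₀ = true := by rw [← foldW_eq_parts, hfold]; exact htp
      rw [Nat.testBit_xor, ← testBit_emb_eq hG hu hp₀, ← testBit_partner_emb_eq hG hu hp₀, hbit,
        Bool.false_xor] at hab
      -- u' has bit emb p₀ = u's bit at partner (emb p₀)
      have : u'.testBit (G.emb p₀) = true := by
        rw [hu', ← hG.partner_partner _ (hG.emb_lt p₀ hp₀),
          partner_eq_transIdx hS (G := G) (hG.partner_lt _ (hG.emb_lt p₀ hp₀))]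
        rw [testBit_transW hl hm _ _ _ (hG.partner_lt _ (hG.emb_lt p₀ hp₀)) (by rw [← Geo.n]; exact hu)]
        exact hab
      rw [hbit'] at this; exact Bool.false_ne_true this
    · exact hQ u hq'
  · exact hq

end Geo

end Summit.Ventures.QEC.Census.Fold
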